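import Literature.IUT.LogThetaLattice.LogWallRemarks
import Summits.ABC.IUTFork.LanaRss
import HarnessLib

/-!
# L-LANA objects IX bis: the log-Kummer correspondence (Fig. 5), upper semi-compatibility, and (Ind3) as an upper bound (LANA §7.2 (b),(c))

Record-only file (D-0012) of the abc-iut cell (seat abc-iut-c312-4, L-LANA level; LLANA-SPEC N16 "log-Kummer
correspondence (Fig. 5; "far from commutative", p. 38); upper semi-compatibility / Ind3 (§7.2 (c))", CONSUMING
corpus layer L6's typing of [IUTchIII] Rem. 1.2.2 (iii), `Literature.IUT.LogThetaLattice.UpperSemiCommutative`);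
TAKES NO SIDE on [IUTchIII] Cor. 3.12. From Project LANA's interim report (bib `LANA2026Report`, read on the
page):

* §7.2 (b) p. 38 / Fig. 5 p. 39: "log-shells of type (HF) … the étale-like portions `⁰'°HT^D`, `¹'°HT^D` … and the
  log-shells of type (HE) `⁰'étI := ⁰'°I(D)` … one can draw a diagram as in Figure 5. Here, Kmm denotes the
  Kummer isomorphisms from Frobenius-like log-shells to étale-like log-shells. This diagram is far from
  commutative" — `LogKummerColumn` (the Frobenius-like carriers `ⁿC` with their (HF) log-shells `ⁿI`, the
  log maps `ⁿC → ⁿ⁺¹C`, the étale carrier with `étI`, and the Kummer maps `ⁿKmm`), `Commutes` (what fails);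
* §7.2 (c) p. 40: "the log-shell acts as an upper-bound that simultaneously contains their images … "upper
  semi-compatibility" between the log-link and the Kummer isomorphisms … Ind3 … is formulated as an
  upper-bound constraint in such a way that, even after undergoing a shift by the log-link, all required
  images remain within the log-shell" — `imageAfterShifts` (the image in the étale carrier of `ⁿI` after
  `k` log-shifts followed by the Kummer map) and `UpperSemiCompatible := UpperSemiCommutative étI (all these
  images)`, i.e. LITERALLY L6's predicate for [IUTchIII] Rem. 1.2.2 (iii) applied to LANA's column (no copy);
* PROVED: `iUnion_images_subset` (all images, over all composites, lie in `étI` — L6's `iUnion_subset`),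
  and the bridge to (Ind3) as an UPPER BOUND at measure level (`LanaRss`): if the étale log-shell is a region
  of the volume container, every measurable image-region has log-volume `≤` that of the shell
  (`logVol_image_le_of_upperSemiCompatible`) — "all we can say is that this is an adelic measurable subset
  of the log-shell version of the volume container (upper-semi compatibility)" (§6 (Ind3) p. 31).

Modelling notes. (i) The carriers are bare types/sets: the field structures `ⁿK̄_v(logF)`, the `p`-adic
logarithm and the Kummer isomorphisms' construction are L4-t2/L6-t3 content ([AbsTopIII] Prop. 3.2,
[IUTchIII] Prop. 1.2); `Kmm` is typed as a map (an isomorphism onto its image in print). (ii) Which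
composites are "required" ((Ind3)'s exact index set) is [IUTchIII] Prop. 3.5 (ii) (seat abc-iut-c312-1,
`Thm311LogKummer`); here the index is (start `n`, number of shifts `k`).
[cite: LANA2026Report, §7.2 (b),(c) pp. 38–40, §6 (Ind3) p. 31] NOT here: any judgement.
-/

noncomputable section

open MeasureTheory

namespace Summit.ABC
namespace IUTFork

open Literature.IUT.LogThetaLattice

/-- **LANA Fig. 5 (one column of the big-H), as data**: Frobenius-like carriers `ⁿC` (`n ∈ ℤ`) with their
(HF) log-shells `ⁿI ⊆ ⁿC`, the log maps `ⁿC → ⁿ⁺¹C` (§5.3 (a)), one étale-like carrier `E` with the (HE)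
log-shell `étI` (Rem. 5.3.1: shared along the column), and the Kummer maps `ⁿKmm : ⁿC → E` ("Kummer
isomorphisms from Frobenius-like log-shells to étale-like log-shells"). [cite: LANA2026Report, §7.2 (b) p. 38] -/
structure LogKummerColumn : Type 1 where
  /-- the Frobenius-like carriers `ⁿC` (`ⁿK̄_v(logF)`) -/
  C : ℤ → Type
  /-- the (HF) log-shells `ⁿI ⊆ ⁿC` -/
  I : ∀ n, Set (C n)
  /-- the log-links `ⁿC → ⁿ⁺¹C` -/
  log : ∀ n, C n → C (n + 1)
  /-- the étale-like carrier (`°K̄_v(D)`) -/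
  E : Type
  /-- the (HE) log-shell `étI = °I(D)` -/
  etI : Set E
  /-- the Kummer maps `ⁿKmm : ⁿC → E` -/
  Kmm : ∀ n, C n → E

namespace LogKummerColumn

variable (L : LogKummerColumn)

/-- What FAILS (§7.2 (b): "This diagram is far from commutative"): compatibility of the Kummer maps with the
log-links, `ⁿ⁺¹Kmm ∘ log = ⁿKmm`. Recorded as a predicate; never assumed. [cite: LANA2026Report, §7.2 (b) p. 38] -/
def Commutes : Prop := ∀ (n : ℤ) (x : L.C n), L.Kmm (n + 1) (L.log n x) = L.Kmm n x

/-- `k` successive log-shifts starting at level `n`: `ⁿC → ⁿ⁺ᵏC`. [cite: LANA2026Report, §7.2 (c) p. 40] -/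
def shift (n : ℤ) : ∀ k : ℕ, L.C n → L.C (n + k)
  | 0 => fun x => cast (by rw [Nat.cast_zero, add_zero]) x
  | k + 1 => fun x => cast (by push_cast; rw [add_assoc]) (L.log (n + k) (shift n k x))

/-- The image in the étale carrier of the (HF) log-shell `ⁿI` "after undergoing a shift by the log-link"
`k` times, read through the Kummer map at level `n + k`. [cite: LANA2026Report, §7.2 (c) p. 40] -/
def imageAfterShifts (i : ℤ × ℕ) : Set L.E := L.Kmm (i.1 + i.2) '' (L.shift i.1 i.2 '' L.I i.1)

/-- **UPPER SEMI-COMPATIBILITY (§7.2 (c); [IUTchIII] Rem. 1.2.2 (iii) via L6's `UpperSemiCommutative`)**: "the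
log-shell acts as an upper-bound that simultaneously contains their images … even after undergoing a shift
by the log-link, all required images remain within the log-shell" — every image `ⁿ⁺ᵏKmm(logᵏ(ⁿI))` lies in
`étI`. HYPOTHESIS-shaped predicate on the column (the real content is [IUTchIII] Prop. 1.2 / 3.5 (ii)).
[cite: LANA2026Report, §7.2 (c) p. 40] -/
def UpperSemiCompatible : Prop := UpperSemiCommutative L.etI L.imageAfterShifts

/-- Under upper semi-compatibility the union of ALL images (all starting levels, all numbers of shifts)
lies in the étale log-shell — the "upper estimate" form (L6 `UpperSemiCommutative.iUnion_subset`).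
[cite: LANA2026Report, §7.2 (c) p. 40] -/
theorem iUnion_images_subset (h : L.UpperSemiCompatible) : (⋃ i, L.imageAfterShifts i) ⊆ L.etI :=
  UpperSemiCommutative.iUnion_subset h

/-- In particular the unshifted Kummer image of each `ⁿI` lies in `étI` (`k = 0`).
[cite: LANA2026Report, §7.2 (b) p. 38] -/
theorem kmm_image_subset (h : L.UpperSemiCompatible) (n : ℤ) : L.imageAfterShifts (n, 0) ⊆ L.etI := h (n, 0)

end LogKummerColumn

/-! ## (Ind3) as an upper bound at measure level -/

/-- **(Ind3) read at log-volume level** (§6 p. 31: "All we can say is that this is an adelic measurable subset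
of the log-shell version of the volume container (upper-semi compatibility) … we must take into account all
such subsets"): if the étale carrier is the volume container with its measure and both the étale log-shell
and an image-region are regions (`LanaRss.Region`), upper semi-compatibility bounds the image's log-volume by
the shell's — monotonicity of the measure (`Region.logVol_mono`). [cite: LANA2026Report, §6 (Ind3) p. 31] -/
theorem logVol_image_le_of_upperSemiCompatible (L : LogKummerColumn) [MeasurableSpace L.E]
    {μ : Measure L.E} (h : L.UpperSemiCompatible) (i : ℤ × ℕ) (T S : Region μ)
    (hT : T.carrier = L.imageAfterShifts i) (hS : S.carrier = L.etI) : T.logVol ≤ S.logVol :=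
  T.logVol_mono S (by rw [hT, hS]; exact h i)

end IUTFork

end Summit.ABC

end
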